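import Summits.Parity.GeneralizedHardyLittlewood.Theorems.FordMaynardNoSieveConst0164NegWitness0164LinnikFour

/-!
# Route `FordMaynardNoSieveConst0164`, crux `NegWitness0164` (stmt-Parity-19102), line `birth`,
# stub `stub_tweakNeg0164`: the four-piece term of `h(1)` vanishes

Eighth helper file toward the certificate stub (K. Ford, J. Maynard, *On the theory of prime producing
sieves*, arXiv:2407.14368, §8, proof of Theorem 2.7 (c): "`f(1) = I₃ + I₅`" — there is no `I₄`, because
"if `x ∈ 𝓗₄` with all components `< 1/2` and no pair of components has sum equal to `1/2` then
`𝓛_{1/2}(x) = 0`").  In the `k = 1` clause of the stub,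
`h(1) = ∑_{n=1}^{6} sliceIntegral n 1 (𝟙[v ≥ 41/250] · blockWeight (1/2) n v · F₀ n v)` (helper file
`…OneClause`), the `n = 4` term is ZERO for every `F₀`: on the slice `{v ∈ (0,∞)^4 : |v| = 1}` the weight
`blockWeight (1/2) 4 v = 𝓛_{1/2}(v)/(4! ∏ vᵢ)` vanishes whenever some `vᵢ ≥ 1/2` (Lemma 5.5 (a)) and,
when all `vᵢ < 1/2`, off the three hyperplanes `{vᵢ + vⱼ = 1/2}` (`linnikFn_four_eq_zero`), a Lebesgue-null
set of the parametrising coordinates `(v₀, v₁, v₂) ∈ ℝ³`.  Def-free.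

* `volume_pairSum_eq` — the hyperplane `{u ∈ ℝ³ : uᵢ + uⱼ = a}` (`i ≠ j`) is Lebesgue-null (a strict
  affine subspace);
* `blockWeight_half_four_snoc_eq_zero` — the pointwise vanishing off the null set;
* `sliceIntegral_four_one_blockWeight_half_mul` — `sliceIntegral 4 1 (v ↦ blockWeight (1/2) 4 v · G v) = 0`
  for every `G`, and the indicator form `sliceIntegral_four_one_indicator_blockWeight_half` used in the stub.

References: [FordMaynard2024PrimeSieves] arXiv:2407.14368, §8 (proof of Theorem 2.7 (c)), Lemma 5.5 (a).
-/

noncomputable section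

open Finset MeasureTheory
open Literature.Combinatorics.Enumerative
open Literature.NumberTheory.Sieve Literature.NumberTheory.Sieve.FordMaynard

namespace Summit.Parity.GeneralizedHardyLittlewood.FordMaynardNoSieveConst0164NegWitness0164

/-- **A skew coordinate hyperplane of `ℝ³` is Lebesgue-null**: `volume {u | u i + u j = a} = 0` for
`i ≠ j` (a strict affine subspace, `Measure.addHaar_affineSubspace`). [folklore] -/
theorem volume_pairSum_eq {i j : Fin 3} (hij : i ≠ j) (a : ℝ) :
    volume {u : Fin 3 → ℝ | u i + u j = a} = 0 := by
  let S : AffineSubspace ℝ (Fin 3 → ℝ) :=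
    { carrier := {u | u i + u j = a}
      smul_vsub_vadd_mem' := by
        intro c p₁ p₂ p₃ h₁ h₂ h₃
        simp only [Set.mem_setOf_eq, vsub_eq_sub, vadd_eq_add, Pi.add_apply, Pi.smul_apply,
          Pi.sub_apply, smul_eq_mul] at h₁ h₂ h₃ ⊢
        linear_combination c * h₁ - c * h₂ + h₃ }
  have hS : S ≠ ⊤ := by
    intro h
    have hmem : (fun k : Fin 3 => if k = i then a + 1 else 0) ∈ S := by
      rw [h]; exact AffineSubspace.mem_top ℝ (Fin 3 → ℝ) _
    change (if i = i then a + 1 else 0) + (if j = i then a + 1 else 0) = a at hmem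
    rw [if_pos rfl, if_neg (Ne.symm hij)] at hmem
    linarith
  exact Measure.addHaar_affineSubspace volume S hS

/-- The union of the three hyperplanes `{u₀+u₁ = a}`, `{u₀+u₂ = a}`, `{u₁+u₂ = a}` of `ℝ³` is
Lebesgue-null. [folklore] -/
theorem volume_pairSum_union_eq (a : ℝ) :
    volume ({u : Fin 3 → ℝ | u 0 + u 1 = a} ∪ {u | u 0 + u 2 = a} ∪ {u | u 1 + u 2 = a}) = 0 := by
  rw [measure_union_null_iff, measure_union_null_iff]
  exact ⟨⟨volume_pairSum_eq (by decide) a, volume_pairSum_eq (by decide) a⟩,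
    volume_pairSum_eq (by decide) a⟩

/-- Components of `Fin.snoc u x : Fin 4 → ℝ` for `u : Fin 3 → ℝ`. [folklore] -/
theorem snoc_three_apply (u : Fin 3 → ℝ) (x : ℝ) :
    (Fin.snoc u x : Fin 4 → ℝ) 0 = u 0 ∧ (Fin.snoc u x : Fin 4 → ℝ) 1 = u 1 ∧
      (Fin.snoc u x : Fin 4 → ℝ) 2 = u 2 ∧ (Fin.snoc u x : Fin 4 → ℝ) 3 = x := by
  refine ⟨?_, ?_, ?_, ?_⟩
  · exact Fin.snoc_castSucc (α := fun _ => ℝ) (p := u) (x := x) (i := 0)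
  · exact Fin.snoc_castSucc (α := fun _ => ℝ) (p := u) (x := x) (i := 1)
  · exact Fin.snoc_castSucc (α := fun _ => ℝ) (p := u) (x := x) (i := 2)
  · exact Fin.snoc_last (α := fun _ => ℝ) (p := u) (x := x)

/-- **Pointwise vanishing of the four-piece weight on the slice `|v| = 1`** (`γ = 1/2`): for
`u ∈ (0,∞)³` with `u₀ + u₁ + u₂ < 1` off the three hyperplanes `{uᵢ + uⱼ = 1/2}`, the block
`v = (u₀, u₁, u₂, 1 - |u|)` has `blockWeight (1/2) 4 v = 0`: if some `vᵢ ≥ 1/2` by Lemma 5.5 (a)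
(`linnikFn_eq_zero_of_mem`), otherwise by `linnikFn_four_eq_zero` (the pairs through `v₃` sum to `1/2`
exactly when the complementary pairs do).
[cite: FordMaynard2024PrimeSieves, §8 (proof of Theorem 2.7 (c)) and Lemma 5.5 (a)] -/
theorem blockWeight_half_four_snoc_eq_zero (u : Fin 3 → ℝ) (hpos : ∀ i, 0 < u i)
    (hsum : ∑ i, u i < 1) (h01 : u 0 + u 1 ≠ 1 / 2) (h02 : u 0 + u 2 ≠ 1 / 2) (h12 : u 1 + u 2 ≠ 1 / 2) :
    blockWeight (1 / 2) 4 (Fin.snoc u (1 - ∑ i, u i)) = 0 := by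
  obtain ⟨e0, e1, e2, e3⟩ := snoc_three_apply u (1 - ∑ i, u i)
  have hs3 : ∑ i, u i = u 0 + u 1 + u 2 := Fin.sum_univ_three u
  generalize (Fin.snoc u (1 - ∑ i, u i) : Fin 4 → ℝ) = v at e0 e1 e2 e3 ⊢
  have hvpos : ∀ t, 0 < v t := by
    intro t
    fin_cases t
    · show 0 < v 0; rw [e0]; exact hpos 0
    · show 0 < v 1; rw [e1]; exact hpos 1
    · show 0 < v 2; rw [e2]; exact hpos 2
    · show 0 < v 3; rw [e3]; linarith
  have hvsum : v 0 + v 1 + v 2 + v 3 = 2 * (1 - 1 / 2) := by rw [e0, e1, e2, e3, hs3]; ring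
  by_cases hbig : ∃ t, 1 - 1 / 2 ≤ v t
  · obtain ⟨t, ht⟩ := hbig
    unfold blockWeight
    rw [linnikFn_eq_zero_of_mem (1 - 1 / 2) v (Finset.mem_univ t) ht fun k _ => (hvpos k).le, zero_div]
  · push Not at hbig
    refine blockWeight_four_eq_zero v hbig hvsum ?_ ?_ ?_
    · rw [e0, e1]; intro h; exact h01 (by linarith)
    · rw [e0, e2]; intro h; exact h02 (by linarith)
    · rw [e0, e3, hs3]; intro h; exact h12 (by linarith)

/-- **The four-piece term of `h(1)` vanishes**: on the slice `{v ∈ (0,∞)⁴ : |v| = 1}` the weight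
`blockWeight (1/2) 4` is zero almost everywhere, so `sliceIntegral 4 1 (v ↦ blockWeight (1/2) 4 v · G v) = 0`
for every `G` (no `I₄` in `f(1) = I₃ + I₅`).
[cite: FordMaynard2024PrimeSieves, §8 (proof of Theorem 2.7 (c), "Thus, f(1) = I₃ + I₅")] -/
theorem sliceIntegral_four_one_blockWeight_half_mul (G : (Fin 4 → ℝ) → ℝ) :
    sliceIntegral 4 1 (fun v => blockWeight (1 / 2) 4 v * G v) = 0 := by
  simp only [sliceIntegral]
  refine integral_eq_zero_of_ae ?_
  filter_upwards [measure_eq_zero_iff_ae_notMem.1 (volume_pairSum_union_eq (1 / 2 : ℝ))] with u hu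
  simp only [Set.mem_union, Set.mem_setOf_eq, not_or] at hu
  obtain ⟨⟨h01, h02⟩, h12⟩ := hu
  split_ifs with hc
  · rw [blockWeight_half_four_snoc_eq_zero u hc.1 hc.2 h01 h02 h12, zero_mul]
    rfl
  · rfl

/-- The indicator form used in the `k = 1` clause of the stub (`tweak_one_eq_sum_sliceIntegral_0164`):
the `n = 4` term `sliceIntegral 4 1 (v ↦ 𝟙[v ≥ η] · blockWeight (1/2) 4 v · F v)` is `0` for every `η`
and `F`. [cite: FordMaynard2024PrimeSieves, §8 (proof of Theorem 2.7 (c))] -/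
theorem sliceIntegral_four_one_indicator_blockWeight_half (η : ℝ) (F : (Fin 4 → ℝ) → ℝ) :
    sliceIntegral 4 1 (fun v => if ∀ t, η ≤ v t then blockWeight (1 / 2) 4 v * F v else 0) = 0 := by
  classical
  have hfun : (fun v : Fin 4 → ℝ => if ∀ t, η ≤ v t then blockWeight (1 / 2) 4 v * F v else 0) =
      fun v => blockWeight (1 / 2) 4 v * (if ∀ t, η ≤ v t then F v else 0) := by
    funext v
    split_ifs <;> simp
  rw [hfun]
  exact sliceIntegral_four_one_blockWeight_half_mul _

end Summit.Parity.GeneralizedHardyLittlewood.FordMaynardNoSieveConst0164NegWitness0164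

end
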